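import Literature.MathematicalPhysics.QuantumFieldTheory.Balaban1983to89.B9CubeBondWeights

/-!
# `Balaban1983to89.B9CubeIndexBondsNearH` — NEAR □ THE INDEX BONDS OF THE CUBE SEQUENCE ARE THE MEMBER'S AND THE WEIGHTS AGREE:
# `Λ_j(□) = Λ_j` on coarse bonds whose fibres lie in `NearH □`, hence `w_□ = w` there (the `Q*(U)aQ(U)`-row agreement input of the bond sector;
# sub-row G-B9-LETTERS, module M5.1c PART 2, item (O4) of r05's HANDOFF)

FRAMING (verbatim cell line):
statement-level skeleton of published theorems with citation tags; proofs where landed; nothing here is a claim about the Yang–Mills mass gap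

Sources under audit (cell lit-balaban): T. Bałaban, *Propagators for lattice gauge theories in a background field*, Commun. Math. Phys. **99**
(1985) 389–434 [`Balaban1985BackgroundPropagators`, "B9"], p. 408 («Ω_n(□) ⊂ Ω_n»), p. 409 l. 1–5, (3.7) p. 391; T. Bałaban, *Propagators and
renormalization transformations for lattice gauge theories. II*, Commun. Math. Phys. **96** (1984) 223–250 [`Balaban1984PropagatorsII`, "[4]"],
(2.3) p. 224, (2.16) p. 225.  Unit `lit-balaban-r05` (r05 gen 77).

## WHAT THIS FILE CERTIFIES (kernel-checked; `i : KIdx`, cube `q`, `F := cubeFamY i q`, fine site `x`, `y = iterBlockOf j x`)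

* `mem_Om_domCube_iff_of_nearH` — if the fine site `x` is near □ (`NearH q (toBox x)`), then `y ∈ Ω_j(□)^{(j)} ↔ y ∈ Ω_j^{(j)}` (both are
  «`j ≤` level at `x`», and the levels agree near □ by `B9CubeSequence408.lev_cubeFam_eq_of_nearH`);
* `deep_domCube_iff_of_nearH` — the same for `Deep j y` (membership of the `(j+1)`-block);
* ★ `lamBond_domCube_iff_of_nearH` — for a coarse `j`-bond `b` whose two endpoint fibres' base points `embIter j b.src ∕ b.tgt` are near □:
  `b ∈ Λ_j(□) ↔ b ∈ Λ_j` (`(domCube i q).LamBond j b ↔ (domT i.hN i.D i.hk).LamBond j b`);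
* ★ `wCubeBond_eq_of_nearH` — on such index bonds of the cube sequence the weight IS the member's: `w_□ ⟨(j,b),h⟩ = i.w ⟨(j,b),h′⟩`.

## HONEST SCOPE

* Bookkeeping of (2.3) for the two sequences; «near □» is file 1's `NearH` at the base points `embIter` of the endpoints (levels are constant on
  blocks, so one fine point per coarse site suffices).  No inequality; nothing about `R_□(U)` (non-local — see r05's HANDOFF caution).
* Nothing is inferred from the manuscript; kernel-checked.  NOT summit progress; the YM mass gap is not proved by any of this.
-/

namespace Literature.MathematicalPhysics.QuantumFieldTheory.Balaban1983to89.B9CubeIndexBondsNearH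

open LatticeFieldCalculus
open Node00
open Literature.MathematicalPhysics.QuantumFieldTheory.Balaban1983to89.B6KLevelCensusIndexV1 (KIdx)
open Literature.MathematicalPhysics.QuantumFieldTheory.Balaban1983to89.B6SectAOperatorsV1 (BondIdx)
open Literature.MathematicalPhysics.QuantumFieldTheory.Balaban1983to89.B6GlobalChartV1 (PV domT toBox)
open Literature.MathematicalPhysics.QuantumFieldTheory.Balaban1983to89.B6Cover236MultiLevelBlocks (cubes)
open Literature.MathematicalPhysics.QuantumFieldTheory.Balaban1983to89.B15DeterminingSets (embIter)
open Literature.MathematicalPhysics.QuantumFieldTheory.Balaban1983to89.B5Eq118OneStroke (iterBlockOf iterBlockOf_succ)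
open Literature.MathematicalPhysics.QuantumFieldTheory.Balaban1983to89.B9CubeSequence408 (NearH)
open Literature.MathematicalPhysics.QuantumFieldTheory.Balaban1983to89.B9CubeLettersOpsL0 (cubeFamY levCubeY_eq_levY_of_nearH)
open Literature.MathematicalPhysics.QuantumFieldTheory.Balaban1983to89.B9CubeBondWeights (domCube wCubeBond wCubeBond_eq_of_lamBond)

variable {d ℓ : ℕ} {hd : 1 ≤ d + 1} {hL : Odd (ℓ + 1) ∧ 1 < ℓ + 1} {b₀ b₁ : ℝ}
variable (i : KIdx d ℓ hd hL b₀ b₁) (q : ↥(cubes (toKT i).D.toDomains))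

/-- the section property of the base-point embedding: `iterBlockOf j (embIter j y) = y`. [cite: Balaban1984PropagatorsII, (2.3) p.224, bookkeeping] -/
theorem iterBlockOf_embIter' : ∀ (j : ℕ), j ≤ i.m + i.K → ∀ y : Site (PV d ℓ i.m i.K hd hL) j, iterBlockOf j (embIter j y) = y
  | 0, _, _ => rfl
  | j + 1, hj, y => by
      show blockOf (iterBlockOf j (embIter j (emb y))) = y
      rw [iterBlockOf_embIter' j (Nat.le_of_succ_le hj), Site.blockOf_emb hj]

/-- ★ near □, `Ω_j(□)^{(j)}` and `Ω_j^{(j)}` have the same members. [cite: Balaban1985BackgroundPropagators, p.408 («Ω_n(□) ⊂ Ω_n», equality on □³); Balaban1984PropagatorsII, (2.3) p.224] -/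
theorem mem_Om_domCube_iff_of_nearH {j : ℕ} (hj : j ≤ i.k) (x : Site (PV d ℓ i.m i.K hd hL) 0) (hx : NearH q (toBox i.hN x).1) :
    iterBlockOf j x ∈ (domCube i q).Om j ↔ iterBlockOf j x ∈ (domT i.hN i.D i.hk).Om j := by
  rcases Nat.eq_zero_or_pos j with h0 | hpos
  · subst h0
    simp only [B6SectADomainsV1.Domains.Om_zero, Finset.mem_univ]
  · rw [B6GlobalChartV1L0.iterBlockOf_mem_domT_iff i.hN (cubeFamY i q) i.hk hj x,
      B6GlobalChartV1.iterBlockOf_mem_domT_iff i.hN i.D i.hk hpos hj x]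
    have h := levCubeY_eq_levY_of_nearH i q (z := toBox i.hN x) hx
    unfold B9CubeLettersOpsL0.levCubeY Node00.levY at h
    constructor
    · intro hle; exact le_of_le_of_eq hle h
    · intro hle; exact le_of_le_of_eq hle h.symm

/-- near □, `Deep j` agrees for the two sequences. [cite: Balaban1985BackgroundPropagators, p.408; Balaban1984PropagatorsII, (2.3) p.224] -/
theorem deep_domCube_iff_of_nearH {j : ℕ} (hj : j ≤ i.k) (x : Site (PV d ℓ i.m i.K hd hL) 0) (hx : NearH q (toBox i.hN x).1) :
    (domCube i q).Deep j (iterBlockOf j x) ↔ (domT i.hN i.D i.hk).Deep j (iterBlockOf j x) := by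
  unfold B6SectADomainsV1.Domains.Deep
  rw [← iterBlockOf_succ]
  rcases Nat.lt_or_ge j i.k with hlt | hge
  · exact mem_Om_domCube_iff_of_nearH i q (Nat.succ_le_of_lt hlt) x hx
  · have hk : i.k < j + 1 := by omega
    have e1 : (domCube i q).Om (j + 1) = ∅ := (domCube i q).Om_eq_empty hk
    have e2 : (domT i.hN i.D i.hk).Om (j + 1) = ∅ := (domT i.hN i.D i.hk).Om_eq_empty hk
    rw [e1, e2]

/-- ★ **NEAR □ THE INDEX BONDS OF THE CUBE SEQUENCE ARE THE MEMBER'S**: for a coarse `j`-bond whose endpoints' base points are near □,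
`b ∈ Λ_j(□) ↔ b ∈ Λ_j`. [cite: Balaban1985BackgroundPropagators, p.408, p.409 l.1–5; Balaban1984PropagatorsII, (2.3) p.224 («Λ_j … also the set of bonds»)] -/
theorem lamBond_domCube_iff_of_nearH {j : ℕ} (hj : j ≤ i.k) (b : PBond (PV d ℓ i.m i.K hd hL) j)
    (hs : NearH q (toBox i.hN (embIter j b.src)).1) (ht : NearH q (toBox i.hN (embIter j b.tgt)).1) :
    (domCube i q).LamBond j b ↔ (domT i.hN i.D i.hk).LamBond j b := by
  have hjm : j ≤ i.m + i.K := hj.trans i.hk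
  have es : iterBlockOf j (embIter j b.src) = b.src := iterBlockOf_embIter' i j hjm b.src
  have et : iterBlockOf j (embIter j b.tgt) = b.tgt := iterBlockOf_embIter' i j hjm b.tgt
  unfold B6SectADomainsV1.Domains.LamBond
  rw [← es, ← et, mem_Om_domCube_iff_of_nearH i q hj _ hs, mem_Om_domCube_iff_of_nearH i q hj _ ht,
    deep_domCube_iff_of_nearH i q hj _ hs, deep_domCube_iff_of_nearH i q hj _ ht]

/-- ★ **NEAR □ THE CUBE SEQUENCE'S BOND WEIGHT IS THE MEMBER'S**. [cite: Balaban1985BackgroundPropagators, p.409 l.1–5, (3.7) p.391; Balaban1984PropagatorsII, (2.16) p.225] -/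
theorem wCubeBond_eq_of_nearH (p : BondIdx (domCube i q))
    (hs : NearH q (toBox i.hN (embIter (p.1.1 : ℕ) p.1.2.src)).1) (ht : NearH q (toBox i.hN (embIter (p.1.1 : ℕ) p.1.2.tgt)).1) :
    ∃ h : (domT i.hN i.D i.hk).LamBond (p.1.1 : ℕ) p.1.2, wCubeBond i q p = i.w ⟨p.1, h⟩ := by
  have hj : (p.1.1 : ℕ) ≤ i.k := Nat.lt_succ_iff.1 p.1.1.2
  have h : (domT i.hN i.D i.hk).LamBond (p.1.1 : ℕ) p.1.2 := (lamBond_domCube_iff_of_nearH i q hj p.1.2 hs ht).1 p.2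
  exact ⟨h, wCubeBond_eq_of_lamBond i q p h⟩

end Literature.MathematicalPhysics.QuantumFieldTheory.Balaban1983to89.B9CubeIndexBondsNearH
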